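import Mathlib
import Literature.NumberTheory.LFunctions.WeilExplicit
import Literature.NumberTheory.LFunctions.WeilExplicitProofs
import Literature.NumberTheory.LFunctions.WeilMellinBounds
import Literature.NumberTheory.LFunctions.WeilArchimedeanMoments
import Literature.Analysis.SpecialFunctions.DigammaLogBound
import Literature.Analysis.SpecialFunctions.DigammaVerticalSeries
import HarnessLib

/-!
# Crux `GroundStateSimpleEven` (stmt-RiemannHypothesis-1526), line `parity-multiplicity-commutator`,
# stub (PC2): pair continuity of the Weil form — the archimedean part

Support file (`--supports stmt-RiemannHypothesis-1526`) for the registered stub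
`stub_pairContinuity_arch` of the skeleton `Cruxes/GroundStateSimpleEven/Lines/parity_multiplicity_commutator.lean`.
Normalisation of `Literature/NumberTheory/LFunctions/WeilExplicit.lean`: `ĝ = weilMellin g`,
`g̃ = weilReflect g`, `⋆ = weilConv`, and
`weilArchIntegral K = ∫ K̂(1/2 + it) Re ψ(1/4 + it/2) dt`.

**Statement** (`Summit.RiemannHypothesis.RiemannHypothesis.Theorems.stub_pairContinuity_arch`).
For `a > 0` there is `C ≥ 0` such that for all window test functions `f, h` on `[-a, a]`
`‖∫ (f ⋆ h̃)^(1/2 + it) Re ψ(1/4 + it/2) dt‖ ≤ C ‖f‖₂ (‖h‖₂ + ‖h'‖₂)`.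
(The constant does not depend on `a`, and the support hypotheses are not used.)

**Proof.** `(f ⋆ h̃)^ = f̂ · (h̃)^` (`weilMellin_weilConv_holds`) and on the critical line
`‖(h̃)^(1/2 + it)‖ = ‖ĥ(1/2 + it)‖` (`weilMellin_weilReflect_holds`, `1 - conj s = s` there), so
`‖∫ K̂ ρ‖ ≤ ∫ ‖f̂‖ · ‖ĥ ρ‖ ≤ √(∫‖f̂‖²) √(∫‖ĥ‖² ρ²)` (Cauchy–Schwarz,
`integral_mul_norm_le_Lp_mul_Lq`), with `ρ(t) = Re ψ(1/4 + it/2)`.  By the logarithmic order of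
`ψ` on vertical lines (`exists_norm_digamma_vertical_le`), `ρ² ≤ C₁ (1 + t²)`; by
`(h')^(1/2 + it) = -it ĥ(1/2 + it)` (`weilMellin_deriv`), `t² ‖ĥ‖² = ‖(h')^‖²`; and by Plancherel
(`integral_norm_sq_weilMellin_half_line`) `∫‖ĝ(1/2 + it)‖² = 2π ∫‖g‖²` for `g = f, h, h'`.  Hence
`∫ ‖ĥ‖² ρ² ≤ 2π C₁ (‖h‖₂² + ‖h'‖₂²)` and `√(x + y) ≤ √x + √y` finishes, with
`C = √(2π) √(2π C₁)`.

Mathlib + the proved tree files `WeilExplicit*.lean`, `WeilMellinBounds.lean`,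
`WeilArchimedeanMoments.lean`, `DigammaLogBound.lean`, `DigammaVerticalSeries.lean` only; no named
fact is used; no definitions.
-/

noncomputable section

open Set MeasureTheory Filter Complex
open scoped Real Topology ComplexConjugate

namespace Summit.RiemannHypothesis.RiemannHypothesis.Theorems.GroundStateSimpleEven

open Literature.NumberTheory.LFunctions
open Literature.Analysis.SpecialFunctions (reDigammaQuarter continuous_reDigammaQuarter)

-- `linter.dupNamespace` is switched off declaration by declaration: the mandated namespace
-- `Summit.RiemannHypothesis.RiemannHypothesis.…` (single-problem summit) repeats a component.

/-! ## The archimedean weight -/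

set_option linter.dupNamespace false in
/-- **Logarithmic order of the archimedean weight, squared.** There is `C > 0` with
`(Re ψ(1/4 + it/2))² ≤ C (1 + t²)` for every real `t`
(`|Re ψ| ≤ ‖ψ(1/4 + it/2)‖ ≤ C₀ + log(1 + |t|/2) ≤ |C₀| + |t|`). [folklore] -/
theorem pairArch_reDigammaQuarter_sq_le :
    ∃ C : ℝ, 0 < C ∧ ∀ t : ℝ, reDigammaQuarter t ^ 2 ≤ C * (1 + t ^ 2) := by
  obtain ⟨C₀, hC₀⟩ :=
    Literature.Analysis.SpecialFunctions.Complex.exists_norm_digamma_vertical_le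
      (a := 1 / 4) (by norm_num)
  refine ⟨2 * (C₀ ^ 2 + 1), by positivity, fun t ↦ ?_⟩
  have hw : (1 / 4 : ℂ) + (t : ℂ) / 2 * I = ((1 / 4 : ℝ) : ℂ) + ((t / 2 : ℝ) : ℂ) * I := by
    push_cast
    ring
  have h1 : |reDigammaQuarter t| ≤ ‖Complex.digamma (1 / 4 + t / 2 * I)‖ :=
    Complex.abs_re_le_norm _
  have h2 := hC₀ (t / 2)
  rw [← hw] at h2
  have h3 : Real.log (1 + |t / 2|) ≤ |t| := by
    have h := Real.log_le_sub_one_of_pos (by positivity : (0 : ℝ) < 1 + |t / 2|)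
    have h' : |t / 2| ≤ |t| := by
      rw [abs_div, abs_two]
      linarith [abs_nonneg t]
    linarith
  have h4 : |reDigammaQuarter t| ≤ |C₀| + |t| := by linarith [le_abs_self C₀]
  have h5 : reDigammaQuarter t ^ 2 ≤ (|C₀| + |t|) ^ 2 := by
    calc reDigammaQuarter t ^ 2 = |reDigammaQuarter t| ^ 2 := (sq_abs _).symm
      _ ≤ (|C₀| + |t|) ^ 2 := pow_le_pow_left₀ (abs_nonneg _) h4 2
  nlinarith [sq_nonneg (|C₀| - |t|), sq_abs C₀, sq_abs t, sq_nonneg (C₀ * t)]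

/-! ## Cauchy–Schwarz on the line -/

set_option linter.dupNamespace false in
/-- **Cauchy–Schwarz** for two complex `L²` functions on the line:
`∫ ‖F‖ ‖G‖ ≤ √(∫‖F‖²) √(∫‖G‖²)` (`integral_mul_norm_le_Lp_mul_Lq` at `p = q = 2`). [folklore] -/
theorem pairArch_integral_norm_mul_norm_le {F G : ℝ → ℂ} (hF : MemLp F 2 volume)
    (hG : MemLp G 2 volume) :
    ∫ t, ‖F t‖ * ‖G t‖ ≤ √(∫ t, ‖F t‖ ^ 2) * √(∫ t, ‖G t‖ ^ 2) := by
  have h2 : ENNReal.ofReal 2 = 2 := by norm_num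
  have hF' : MemLp F (ENNReal.ofReal 2) volume := by rw [h2]; exact hF
  have hG' : MemLp G (ENNReal.ofReal 2) volume := by rw [h2]; exact hG
  have h := integral_mul_norm_le_Lp_mul_Lq Real.HolderConjugate.two_two hF' hG'
  simp only [Real.rpow_two] at h
  rw [Real.sqrt_eq_rpow, Real.sqrt_eq_rpow]
  exact h

/-! ## The critical line: reflection, derivative, weighted Plancherel -/

set_option linter.dupNamespace false in
/-- On the critical line the involution does not change the modulus of the transform:
`‖(h̃)^(1/2 + it)‖ = ‖ĥ(1/2 + it)‖` (`(h̃)^(s) = conj ĥ(1 - conj s)` and `1 - conj s = s` for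
`Re s = 1/2`). [folklore] -/
theorem pairArch_norm_weilMellin_weilReflect (h : ℝ → ℂ) (t : ℝ) :
    ‖weilMellin (weilReflect h) (1 / 2 + t * I)‖ = ‖weilMellin h (1 / 2 + t * I)‖ := by
  rw [weilMellin_weilReflect_holds, Complex.norm_conj]
  have h1 : 1 - conj ((1 / 2 : ℂ) + t * I) = 1 / 2 + t * I := by
    apply Complex.ext
    · simp
      norm_num
    · simp
  rw [h1]

set_option linter.dupNamespace false in
/-- `‖(h')^(1/2 + it)‖² = ‖ĥ(1/2 + it)‖² t²` for a test function `h` (`weilMellin_deriv`). [folklore] -/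
theorem pairArch_norm_sq_weilMellin_deriv {h : ℝ → ℂ} (hh : IsWeilTest h) (t : ℝ) :
    ‖weilMellin (deriv h) (1 / 2 + t * I)‖ ^ 2 = ‖weilMellin h (1 / 2 + t * I)‖ ^ 2 * t ^ 2 := by
  rw [weilMellin_deriv hh, norm_mul, mul_pow]
  have h1 : ‖-((1 / 2 : ℂ) + t * I - 1 / 2)‖ = |t| := by
    rw [norm_neg, show (1 / 2 : ℂ) + t * I - 1 / 2 = t * I by ring, norm_mul, Complex.norm_I,
      mul_one, Complex.norm_real, Real.norm_eq_abs]
  rw [h1, sq_abs, mul_comm]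

set_option linter.dupNamespace false in
/-- **Weighted Plancherel bound for the `h`-factor.** If `ρ² ≤ C₁(1 + t²)` with
`ρ(t) = Re ψ(1/4 + it/2)`, then for a test function `h` the function `‖ĥ(1/2 + it) ρ(t)‖²` is
integrable and `∫ ‖ĥ(1/2 + it) ρ(t)‖² dt ≤ 2π C₁ (∫‖h‖² + ∫‖h'‖²)`
(Plancherel for `h` and `h'`, `(h')^(1/2 + it) = -it ĥ(1/2 + it)`). [folklore] -/
theorem pairArch_integral_norm_sq_weighted_le {C₁ : ℝ}
    (hρ : ∀ t : ℝ, reDigammaQuarter t ^ 2 ≤ C₁ * (1 + t ^ 2)) {h : ℝ → ℂ} (hh : IsWeilTest h) :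
    Integrable (fun t : ℝ ↦ ‖weilMellin h (1 / 2 + t * I) * (reDigammaQuarter t : ℂ)‖ ^ 2) ∧
      ∫ t : ℝ, ‖weilMellin h (1 / 2 + t * I) * (reDigammaQuarter t : ℂ)‖ ^ 2 ≤
        2 * π * C₁ * ((∫ t, ‖h t‖ ^ 2) + ∫ t, ‖deriv h t‖ ^ 2) := by
  have hnorm : ∀ t : ℝ, ‖weilMellin h (1 / 2 + t * I) * (reDigammaQuarter t : ℂ)‖ ^ 2 =
      ‖weilMellin h (1 / 2 + t * I)‖ ^ 2 * reDigammaQuarter t ^ 2 := by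
    intro t
    rw [norm_mul, mul_pow, Complex.norm_real, Real.norm_eq_abs, sq_abs]
  have hI1 := integrable_norm_sq_weilMellin_half_line hh
  have hI2 := integrable_norm_sq_weilMellin_half_line hh.deriv
  have hP1 := integral_norm_sq_weilMellin_half_line hh
  have hP2 := integral_norm_sq_weilMellin_half_line hh.deriv
  -- the dominating integrable function
  have hdom : ∀ t : ℝ, ‖weilMellin h (1 / 2 + t * I) * (reDigammaQuarter t : ℂ)‖ ^ 2 ≤
      C₁ * ‖weilMellin h (1 / 2 + t * I)‖ ^ 2 +
        C₁ * ‖weilMellin (deriv h) (1 / 2 + t * I)‖ ^ 2 := by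
    intro t
    rw [hnorm, pairArch_norm_sq_weilMellin_deriv hh]
    have h0 : 0 ≤ ‖weilMellin h (1 / 2 + t * I)‖ ^ 2 := sq_nonneg _
    calc ‖weilMellin h (1 / 2 + t * I)‖ ^ 2 * reDigammaQuarter t ^ 2
        ≤ ‖weilMellin h (1 / 2 + t * I)‖ ^ 2 * (C₁ * (1 + t ^ 2)) :=
          mul_le_mul_of_nonneg_left (hρ t) h0
      _ = _ := by ring
  have hdomInt : Integrable fun t : ℝ ↦ C₁ * ‖weilMellin h (1 / 2 + t * I)‖ ^ 2 +
      C₁ * ‖weilMellin (deriv h) (1 / 2 + t * I)‖ ^ 2 :=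
    (hI1.const_mul C₁).add (hI2.const_mul C₁)
  have hc : Continuous fun t : ℝ ↦ weilMellin h (1 / 2 + t * I) * (reDigammaQuarter t : ℂ) :=
    ((continuous_weilMellin hh.1.continuous hh.2).comp
      (by fun_prop : Continuous fun t : ℝ ↦ (1 / 2 : ℂ) + t * I)).mul
      (continuous_ofReal.comp continuous_reDigammaQuarter)
  have hInt : Integrable
      (fun t : ℝ ↦ ‖weilMellin h (1 / 2 + t * I) * (reDigammaQuarter t : ℂ)‖ ^ 2) :=
    hdomInt.mono' (hc.norm.pow 2).aestronglyMeasurable (Eventually.of_forall fun t ↦ by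
      rw [Real.norm_of_nonneg (by positivity)]
      exact hdom t)
  refine ⟨hInt, ?_⟩
  calc ∫ t : ℝ, ‖weilMellin h (1 / 2 + t * I) * (reDigammaQuarter t : ℂ)‖ ^ 2
      ≤ ∫ t : ℝ, (C₁ * ‖weilMellin h (1 / 2 + t * I)‖ ^ 2 +
          C₁ * ‖weilMellin (deriv h) (1 / 2 + t * I)‖ ^ 2) := integral_mono hInt hdomInt hdom
    _ = C₁ * (2 * π * weilNorm2Sq h) + C₁ * (2 * π * weilNorm2Sq (deriv h)) := by
        rw [integral_add (hI1.const_mul C₁) (hI2.const_mul C₁), integral_const_mul,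
          integral_const_mul, hP1, hP2]
    _ = 2 * π * C₁ * ((∫ t, ‖h t‖ ^ 2) + ∫ t, ‖deriv h t‖ ^ 2) := by
        unfold weilNorm2Sq
        ring

/-! ## The archimedean pair-continuity bound -/

set_option linter.dupNamespace false in
/-- **The `a`-free core of (PC2).** If `ρ² ≤ C₁ (1 + t²)` (`ρ(t) = Re ψ(1/4 + it/2)`, `C₁ ≥ 0`),
then for all test functions `f, h`
`‖∫ (f ⋆ h̃)^(1/2 + it) ρ(t) dt‖ ≤ √(2π) √(2π C₁) ‖f‖₂ (‖h‖₂ + ‖h'‖₂)`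
(`K̂ = f̂ (h̃)^`, `‖(h̃)^‖ = ‖ĥ‖` on the line, Cauchy–Schwarz, Plancherel,
`pairArch_integral_norm_sq_weighted_le`). [folklore] -/
theorem pairArch_norm_weilArchIntegral_le {C₁ : ℝ} (hC₁ : 0 ≤ C₁)
    (hρ : ∀ t : ℝ, reDigammaQuarter t ^ 2 ≤ C₁ * (1 + t ^ 2))
    {f h : ℝ → ℂ} (hf : IsWeilTest f) (hh : IsWeilTest h) :
    ‖weilArchIntegral (weilConv f (weilReflect h))‖ ≤
      √(2 * π) * √(2 * π * C₁) * √(∫ t, ‖f t‖ ^ 2) *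
        (√(∫ t, ‖h t‖ ^ 2) + √(∫ t, ‖deriv h t‖ ^ 2)) := by
  obtain ⟨hGint, hGle⟩ := pairArch_integral_norm_sq_weighted_le hρ hh
  have hR : IsWeilTest (weilReflect h) := hh.weilReflect
  have hMK : ∀ s, weilMellin (weilConv f (weilReflect h)) s =
      weilMellin f s * weilMellin (weilReflect h) s :=
    weilMellin_weilConv_holds hf.1.continuous hf.2 hR.1.continuous hR.2
  -- Step 1: `‖∫ K̂ ρ‖ ≤ ∫ ‖f̂‖ ‖ĥ ρ‖`
  have hpt : (fun t : ℝ ↦ ‖weilMellin (weilConv f (weilReflect h)) (1 / 2 + t * I) *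
      ((Complex.digamma (1 / 4 + t / 2 * I)).re : ℂ)‖) =
      fun t : ℝ ↦ ‖weilMellin f (1 / 2 + t * I)‖ *
        ‖weilMellin h (1 / 2 + t * I) * (reDigammaQuarter t : ℂ)‖ := by
    funext t
    rw [hMK, norm_mul, norm_mul, norm_mul, pairArch_norm_weilMellin_weilReflect, mul_assoc]
    rfl
  have h1 : ‖weilArchIntegral (weilConv f (weilReflect h))‖ ≤
      ∫ t : ℝ, ‖weilMellin f (1 / 2 + t * I)‖ *
        ‖weilMellin h (1 / 2 + t * I) * (reDigammaQuarter t : ℂ)‖ := by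
    unfold weilArchIntegral
    rw [← hpt]
    exact norm_integral_le_integral_norm _
  -- Step 2: both factors are in `L²`
  have hcf : Continuous fun t : ℝ ↦ weilMellin f (1 / 2 + t * I) :=
    (continuous_weilMellin hf.1.continuous hf.2).comp
      (by fun_prop : Continuous fun t : ℝ ↦ (1 / 2 : ℂ) + t * I)
  have hch : Continuous fun t : ℝ ↦ weilMellin h (1 / 2 + t * I) * (reDigammaQuarter t : ℂ) :=
    ((continuous_weilMellin hh.1.continuous hh.2).comp
      (by fun_prop : Continuous fun t : ℝ ↦ (1 / 2 : ℂ) + t * I)).mul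
      (continuous_ofReal.comp continuous_reDigammaQuarter)
  have hF2 : MemLp (fun t : ℝ ↦ weilMellin f (1 / 2 + t * I)) 2 volume :=
    (memLp_two_iff_integrable_sq_norm hcf.aestronglyMeasurable).2
      (integrable_norm_sq_weilMellin_half_line hf)
  have hG2 : MemLp (fun t : ℝ ↦ weilMellin h (1 / 2 + t * I) * (reDigammaQuarter t : ℂ))
      2 volume :=
    (memLp_two_iff_integrable_sq_norm hch.aestronglyMeasurable).2 hGint
  -- Step 3: Plancherel for `f` and assembly
  have hNf : 0 ≤ ∫ t, ‖f t‖ ^ 2 := integral_nonneg fun _ ↦ by positivity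
  have hNh : 0 ≤ ∫ t, ‖h t‖ ^ 2 := integral_nonneg fun _ ↦ by positivity
  have hNh' : 0 ≤ ∫ t, ‖deriv h t‖ ^ 2 := integral_nonneg fun _ ↦ by positivity
  have hPf : ∫ t : ℝ, ‖weilMellin f (1 / 2 + t * I)‖ ^ 2 = 2 * π * ∫ t, ‖f t‖ ^ 2 :=
    integral_norm_sq_weilMellin_half_line hf
  have h2π : (0 : ℝ) ≤ 2 * π := by positivity
  have h2πC : (0 : ℝ) ≤ 2 * π * C₁ := by positivity
  -- `√(x + y) ≤ √x + √y`
  have hsqrt : ∀ x y : ℝ, 0 ≤ x → 0 ≤ y → √(x + y) ≤ √x + √y := fun x y hx hy ↦ by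
    rw [Real.sqrt_le_left (by positivity)]
    nlinarith [Real.sq_sqrt hx, Real.sq_sqrt hy, Real.sqrt_nonneg x, Real.sqrt_nonneg y]
  calc ‖weilArchIntegral (weilConv f (weilReflect h))‖
      ≤ ∫ t : ℝ, ‖weilMellin f (1 / 2 + t * I)‖ *
          ‖weilMellin h (1 / 2 + t * I) * (reDigammaQuarter t : ℂ)‖ := h1
    _ ≤ √(∫ t : ℝ, ‖weilMellin f (1 / 2 + t * I)‖ ^ 2) *
          √(∫ t : ℝ, ‖weilMellin h (1 / 2 + t * I) * (reDigammaQuarter t : ℂ)‖ ^ 2) :=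
        pairArch_integral_norm_mul_norm_le hF2 hG2
    _ ≤ √(2 * π * ∫ t, ‖f t‖ ^ 2) *
          √(2 * π * C₁ * ((∫ t, ‖h t‖ ^ 2) + ∫ t, ‖deriv h t‖ ^ 2)) := by
        rw [hPf]
        exact mul_le_mul_of_nonneg_left (Real.sqrt_le_sqrt hGle) (Real.sqrt_nonneg _)
    _ ≤ √(2 * π * ∫ t, ‖f t‖ ^ 2) *
          (√(2 * π * C₁ * ∫ t, ‖h t‖ ^ 2) + √(2 * π * C₁ * ∫ t, ‖deriv h t‖ ^ 2)) := by
        rw [mul_add (2 * π * C₁)]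
        exact mul_le_mul_of_nonneg_left
          (hsqrt _ _ (mul_nonneg h2πC hNh) (mul_nonneg h2πC hNh')) (Real.sqrt_nonneg _)
    _ = √(2 * π) * √(2 * π * C₁) * √(∫ t, ‖f t‖ ^ 2) *
          (√(∫ t, ‖h t‖ ^ 2) + √(∫ t, ‖deriv h t‖ ^ 2)) := by
        rw [Real.sqrt_mul h2π (∫ t, ‖f t‖ ^ 2), Real.sqrt_mul h2πC (∫ t, ‖h t‖ ^ 2),
          Real.sqrt_mul h2πC (∫ t, ‖deriv h t‖ ^ 2)]
        ring

end Summit.RiemannHypothesis.RiemannHypothesis.Theorems.GroundStateSimpleEven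

namespace Summit.RiemannHypothesis.RiemannHypothesis.Theorems

open Literature.NumberTheory.LFunctions

set_option linter.dupNamespace false in
/-- **Registered stub (PC2) of line `parity-multiplicity-commutator` — pair continuity of the Weil
form, archimedean part.** For `a > 0` there is `C ≥ 0` such that for all window test functions
`f, h` on `[-a, a]`:
`‖∫ (f ⋆ h̃)^(1/2 + it) Re ψ(1/4 + it/2) dt‖ ≤ C ‖f‖₂ (‖h‖₂ + ‖h'‖₂)`
(`(f ⋆ h̃)^ = f̂ · (h̃)^`, Cauchy–Schwarz on the critical line, Plancherel
`∫|ĝ(1/2 + it)|² = 2π‖g‖₂²`, `(h')^(1/2 + it) = -it ĥ(1/2 + it)` and the logarithmic order of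
`ψ` on vertical lines; `GroundStateSimpleEven.pairArch_norm_weilArchIntegral_le`). [folklore] -/
theorem stub_pairContinuity_arch :
    ∀ a : ℝ, 0 < a → ∃ C : ℝ, 0 ≤ C ∧ ∀ f h : ℝ → ℂ, IsWeilTest f → tsupport f ⊆ Icc (-a) a →
      IsWeilTest h → tsupport h ⊆ Icc (-a) a →
        ‖weilArchIntegral (weilConv f (weilReflect h))‖ ≤
          C * √(∫ t, ‖f t‖ ^ 2) * (√(∫ t, ‖h t‖ ^ 2) + √(∫ t, ‖deriv h t‖ ^ 2)) := by
  intro a _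
  obtain ⟨C₁, hC₁, hρ⟩ := GroundStateSimpleEven.pairArch_reDigammaQuarter_sq_le
  exact ⟨√(2 * π) * √(2 * π * C₁), by positivity, fun f h hf _ hh _ ↦
    GroundStateSimpleEven.pairArch_norm_weilArchIntegral_le hC₁.le hρ hf hh⟩

end Summit.RiemannHypothesis.RiemannHypothesis.Theorems

end
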